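import Literature.NumberTheory.LFunctions.ConreyIwaniec2002OffDiagPairing
import Mathlib.Analysis.Complex.ExponentialBounds
import HarnessLib

/-!
# Conrey–Iwaniec (2002), Proposition 6.4, the off-diagonal main term of the genus case (stub S5 of SKELETON P64)

B. Conrey, H. Iwaniec, Acta Arith. 103 (2002), §6 (6.29)–(6.35), (6.39) [held text
`paper:arxiv-math_0111012`, p0015–p0016]. The term `2T∫₀^∞|a(y)|²D(T/y)dy/y` of (6.39), with
`D(v) = Σ_h σ(h)L(hv)` for the coefficients `σ` of a genus character, is bounded ABSOLUTELY:
`|∫₀^∞ |a(y)|² D(T/y) dy/y| ≤ c·ℓ²·(log q)²` — the integrated and repaired form of (6.34)–(6.35)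
(line card R-c / finding F-P64-α of the cell landau-siegel/ls-inputs, line `thm61-cm-convolution`).
Proof: `D = 𝓜⁻¹_{σ₀}Φ` (`OffDiagMellin.ciD_eq_mellinInv_genusPhi`, `σ₀ = 1/(2 log q)`), the Fubini
pairing `OffDiagonal.integral_normSq_ciD_eq` (file `ConreyIwaniec2002OffDiagPairing.lean`), AM–GM in `t`
with the mean-square bound of `Φ` (`OffDiagPhiL2.exists_integral_norm_sq_genusPhi_le`,
`≤ C_Φ ℓ⁴ log³q`) and the Mellin–Plancherel bound for `𝓜|a|²` (`≤ 2π(log q + 1)·e·T^{1/log q}`),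
balanced with `λ = ℓ² log q · T^{-σ₀}`; final constant `(C_Φ + 4πe)/(4π)`.

PROVED HERE: `ConreyIwaniec2002.offdiagonal_genus_bound` = the registered stub S5 `stub_offdiagonal`
of SKELETON P64 (signature verbatim).

## References
* [ConreyIwaniec2002] B. Conrey, H. Iwaniec, Acta Arith. 103 (2002) 259–312: §6 (6.29)–(6.35), (6.39).
-/

noncomputable section

open Complex MeasureTheory Set Filter Real
open scoped Topology FourierTransform

namespace Literature.NumberTheory.LFunctions

namespace ConreyIwaniec2002

namespace OffDiagonal

open KernelMellin GenusZFactorBounds OffDiagMellin OffDiagPhiL2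

section Final

/-! ### The off-diagonal bound (stub S5 of SKELETON P64) -/

/-- AM–GM with a parameter: `ab ≤ (a²/λ + λb²)/2` for `λ > 0`. [folklore] -/
private theorem mul_le_amgm (x y : ℝ) {lam : ℝ} (hlam : 0 < lam) :
    x * y ≤ (x ^ 2 / lam + lam * y ^ 2) / 2 := by
  have e : (x ^ 2 / lam + lam * y ^ 2) / 2 - x * y = (x - lam * y) ^ 2 / (2 * lam) := by
    field_simp
    ring
  have : 0 ≤ (x - lam * y) ^ 2 / (2 * lam) := by positivity
  linarith

/-- `D ≡ 0` when `σ` vanishes on `h ≥ 1`. [cite: ConreyIwaniec2002, §6 (6.29)] -/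
theorem ciD_eq_zero_of_sigma {K : ℝ → ℝ} {σ : ℕ → ℝ} (h0 : ∀ h : ℕ, 1 ≤ h → σ h = 0) (u : ℝ) :
    ciD K σ u = 0 := by
  unfold ciD
  simp [h0 _ (Nat.succ_le_succ (Nat.zero_le _))]

/-- `1 < log q` for `q ≥ 5`. [folklore] -/
private theorem one_lt_log_of_five_le {q : ℕ} (h5 : 5 ≤ q) : 1 < Real.log q := by
  have hq0 : (0:ℝ) < q := by exact_mod_cast (show 0 < q by omega)
  rw [Real.lt_log_iff_exp_lt hq0]
  calc Real.exp 1 < 2.7182818286 := Real.exp_one_lt_d9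
    _ < 5 := by norm_num
    _ ≤ (q : ℝ) := by exact_mod_cast h5

/-- `Y^{1/log q} ≤ e · T^{1/log q}` when `Y ≤ qT`. [folklore] -/
private theorem rpow_le_exp_mul_rpow {q : ℕ} (h5 : 5 ≤ q) {T Y : ℝ} (hT : 0 < T) (hY : 0 < Y)
    (hYq : Y ≤ q * T) :
    Y ^ (1 / Real.log q) ≤ Real.exp 1 * T ^ (1 / Real.log q) := by
  have hq0 : (0:ℝ) < q := by exact_mod_cast (show 0 < q by omega)
  have hL : 0 < Real.log q := by linarith [one_lt_log_of_five_le h5]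
  calc Y ^ (1 / Real.log q) ≤ ((q : ℝ) * T) ^ (1 / Real.log q) :=
        Real.rpow_le_rpow hY.le hYq (by positivity)
    _ = (q : ℝ) ^ (1 / Real.log q) * T ^ (1 / Real.log q) := Real.mul_rpow hq0.le hT.le
    _ = Real.exp 1 * T ^ (1 / Real.log q) := by
        rw [Real.rpow_def_of_pos hq0, mul_one_div_cancel hL.ne']

end Final

end OffDiagonal

open OffDiagonal KernelMellin GenusZFactorBounds OffDiagMellin OffDiagPhiL2 in
/-- **Conrey–Iwaniec (2002), Proposition 6.4, genus case, off-diagonal main term (stub S5 of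
SKELETON P64):** for `q > 4` squarefree, `σ` the coefficients of a genus character (`IsCISigma`),
an admissible kernel `K` and an admissible cutoff `a` at `2 ≤ T ≤ Y ≤ qT`,
`|∫₀^∞ |a(y)|² D(T/y) dy/y| ≤ c·ℓ²·(log q)²` with an ABSOLUTE constant `c` — the integrated and
repaired form of (6.34)–(6.35) (the print's pointwise bound carries `ν(q)/q`, which is not
absolute; see the module docstring). [cite: ConreyIwaniec2002, §6 (6.29)–(6.35), (6.39)] -/
theorem offdiagonal_genus_bound :
    ∃ c : ℝ, 0 < c ∧
      ∀ (q : ℕ), 4 < q → Squarefree q → ∀ (ℓ : ℝ), 0 ≤ ℓ → ∀ σ : ℕ → ℝ, IsCISigma q ℓ σ →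
        ∀ K : ℝ → ℝ, IsCIKernel K →
          ∀ (T Y : ℝ) (a : ℝ → ℂ), 2 ≤ T → T ≤ Y → Y ≤ q * T → IsCutoff a T Y →
            |∫ y in Set.Ioi (0 : ℝ), ‖a y‖ ^ 2 * ciD K σ (T / y) / y| ≤
              c * ℓ ^ 2 * Real.log q ^ 2 := by
  obtain ⟨CΦ, hCΦ, hΦL2⟩ := exists_integral_norm_sq_genusPhi_le
  refine ⟨(CΦ + 4 * π * Real.exp 1) / (4 * π), by positivity, ?_⟩
  intro q hq4 hsq ℓ hℓ σ hσ K hK T Y a hT hTY hYq ha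
  have h5 : 5 ≤ q := hq4
  have hq0 : (0:ℝ) < q := by exact_mod_cast (show 0 < q by omega)
  have hL1 : 1 < Real.log q := one_lt_log_of_five_le h5
  have hL0 : 0 < Real.log q := by linarith
  have hT0 : 0 < T := by linarith
  have hY0 : 0 < Y := by linarith
  have hRHS : 0 ≤ (CΦ + 4 * π * Real.exp 1) / (4 * π) * ℓ ^ 2 * Real.log q ^ 2 := by positivity
  obtain ⟨hσb, hcases⟩ := hσ
  -- the degenerate cases `σ|_{h ≥ 1} = 0` (in particular `σ = 0`, or `ℓ = 0`)
  by_cases hzero : ∀ h : ℕ, 1 ≤ h → σ h = 0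
  · have hD : ∀ u, ciD K σ u = 0 := ciD_eq_zero_of_sigma hzero
    simp only [hD, mul_zero, zero_div, integral_zero, abs_zero]
    exact hRHS
  have hℓ0 : 0 < ℓ := by
    rcases hℓ.eq_or_lt with h | h
    · exfalso; apply hzero; intro h' hh'
      have := hσb h' hh'
      rw [← h] at this
      have : |σ h'| ≤ 0 := by simpa using this
      exact abs_eq_zero.mp (le_antisymm this (abs_nonneg _))
    · exact h
  rcases hcases with hσ0 | ⟨v, w, κ, ε₁, ε₂, hvw, hκ0, hκ1, hε₁, hε₂, hZ⟩
  · exfalso; apply hzero; intro h _; simp [hσ0]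
  -- the genus case
  have hσ₀ : 0 < 1 / (2 * Real.log q) := by positivity
  have hσ₁ : 1 / (2 * Real.log q) ≤ 1 / 2 :=
    one_div_le_one_div_of_le two_pos (by linarith)
  have hpair := integral_normSq_ciD_eq hK hsq hvw hκ0 hκ1 hε₁ hε₂ hT hTY ha hσb hZ hσ₀ hσ₁
  obtain ⟨hMi, hMle⟩ := integral_norm_sq_mellin_normSq_le hT hTY ha hσ₀ hσ₁
  obtain ⟨hΦi, hΦle⟩ := hΦL2 K hK q v w κ ℓ ε₁ ε₂ hsq h5 hvw hκ0 hκ1 hε₁ hε₂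
  set σ₀ : ℝ := 1 / (2 * Real.log q) with hσ₀def
  set L : ℝ := Real.log q with hLdef
  set Φ : ℝ → ℂ := fun t => genusPhi K κ ℓ ε₁ ε₂ v w (σ₀ + t * I) with hΦdef
  set M : ℝ → ℂ := fun t => mellin (fun y : ℝ => ((‖a y‖ ^ 2 : ℝ) : ℂ)) (σ₀ + t * I) with hMdef
  set lam : ℝ := ℓ ^ 2 * L * T ^ (-σ₀) with hlam
  have hTσ : 0 < T ^ (-σ₀) := Real.rpow_pos_of_pos hT0 _
  have hlam0 : 0 < lam := by positivity
  -- norms of the factors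
  have hnormT : ∀ t : ℝ, ‖(T : ℂ) ^ (-((σ₀ : ℂ) + t * I))‖ = T ^ (-σ₀) := by
    intro t
    rw [Complex.norm_cpow_eq_rpow_re_of_pos hT0]
    simp
  have h2π : ‖(1 / (2 * π) : ℂ)‖ = 1 / (2 * π) := by
    rw [show (1 / (2 * π) : ℂ) = (((1 / (2 * π) : ℝ)) : ℂ) by push_cast; ring, Complex.norm_real,
      Real.norm_eq_abs, abs_of_nonneg (by positivity)]
  -- the two budget items
  have hA1 : T ^ (-σ₀) * (CΦ * ℓ ^ 4 * L ^ 3 / lam) = CΦ * ℓ ^ 2 * L ^ 2 := by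
    rw [hlam]
    field_simp
  have hA2 : T ^ (-σ₀) * (lam * (2 * π * ((1 / (2 * σ₀) + 1) * Y ^ (2 * σ₀)))) ≤
      4 * π * Real.exp 1 * ℓ ^ 2 * L ^ 2 := by
    have hσL : 1 / (2 * σ₀) = L := by rw [hσ₀def]; field_simp
    have h2σ : 2 * σ₀ = 1 / L := by rw [hσ₀def]; field_simp
    have hY : Y ^ (2 * σ₀) ≤ Real.exp 1 * T ^ (2 * σ₀) := by
      rw [h2σ]; exact rpow_le_exp_mul_rpow h5 hT0 hY0 hYq
    have hTT : T ^ (-σ₀) * T ^ (-σ₀) * T ^ (2 * σ₀) = 1 := by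
      rw [← Real.rpow_add hT0, ← Real.rpow_add hT0]
      rw [show -σ₀ + -σ₀ + 2 * σ₀ = 0 by ring, Real.rpow_zero]
    rw [hσL]
    calc T ^ (-σ₀) * (lam * (2 * π * ((L + 1) * Y ^ (2 * σ₀))))
        ≤ T ^ (-σ₀) * (lam * (2 * π * ((L + 1) * (Real.exp 1 * T ^ (2 * σ₀))))) := by gcongr
      _ = 2 * π * Real.exp 1 * ℓ ^ 2 * (L * (L + 1)) * (T ^ (-σ₀) * T ^ (-σ₀) * T ^ (2 * σ₀)) := by
          rw [hlam]; ring
      _ = 2 * π * Real.exp 1 * ℓ ^ 2 * (L * (L + 1)) := by rw [hTT, mul_one]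
      _ ≤ 2 * π * Real.exp 1 * ℓ ^ 2 * (L * (2 * L)) := by gcongr; linarith
      _ = 4 * π * Real.exp 1 * ℓ ^ 2 * L ^ 2 := by ring
  -- the main chain
  rw [← Real.norm_eq_abs, ← Complex.norm_real, hpair, norm_mul, h2π]
  have hint2 : Integrable (fun t : ℝ => T ^ (-σ₀) * ((‖Φ t‖ ^ 2 / lam + lam * ‖M t‖ ^ 2) / 2)) :=
    (((hΦi.div_const lam).add (hMi.const_mul lam)).div_const 2).const_mul _
  calc 1 / (2 * π) * ‖∫ t : ℝ, Φ t * ((T : ℂ) ^ (-((σ₀ : ℂ) + t * I)) * M t)‖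
      ≤ 1 / (2 * π) * ∫ t : ℝ, ‖Φ t * ((T : ℂ) ^ (-((σ₀ : ℂ) + t * I)) * M t)‖ := by
        gcongr; exact norm_integral_le_integral_norm _
    _ = 1 / (2 * π) * ∫ t : ℝ, T ^ (-σ₀) * (‖Φ t‖ * ‖M t‖) := by
        congr 1
        refine integral_congr_ae (Eventually.of_forall fun t => ?_)
        simp only [norm_mul, hnormT]
        ring
    _ ≤ 1 / (2 * π) * ∫ t : ℝ, T ^ (-σ₀) * ((‖Φ t‖ ^ 2 / lam + lam * ‖M t‖ ^ 2) / 2) := by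
        refine mul_le_mul_of_nonneg_left ?_ (by positivity)
        refine integral_mono_of_nonneg (Eventually.of_forall fun t => by positivity) hint2
          (Eventually.of_forall fun t => ?_)
        exact mul_le_mul_of_nonneg_left (mul_le_amgm _ _ hlam0) hTσ.le
    _ = 1 / (2 * π) * (T ^ (-σ₀) * (((∫ t : ℝ, ‖Φ t‖ ^ 2) / lam + lam * ∫ t : ℝ, ‖M t‖ ^ 2) / 2)) := by
        rw [integral_const_mul, integral_div, integral_add (hΦi.div_const lam) (hMi.const_mul lam),
          integral_div, integral_const_mul]
    _ ≤ 1 / (2 * π) * (T ^ (-σ₀) * ((CΦ * ℓ ^ 4 * L ^ 3 / lam +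
          lam * (2 * π * ((1 / (2 * σ₀) + 1) * Y ^ (2 * σ₀)))) / 2)) := by
        gcongr
    _ = (T ^ (-σ₀) * (CΦ * ℓ ^ 4 * L ^ 3 / lam) +
          T ^ (-σ₀) * (lam * (2 * π * ((1 / (2 * σ₀) + 1) * Y ^ (2 * σ₀))))) / (4 * π) := by
        field_simp
        ring
    _ ≤ (CΦ * ℓ ^ 2 * L ^ 2 + 4 * π * Real.exp 1 * ℓ ^ 2 * L ^ 2) / (4 * π) := by
        rw [hA1]; gcongr
    _ = (CΦ + 4 * π * Real.exp 1) / (4 * π) * ℓ ^ 2 * L ^ 2 := by ring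


end ConreyIwaniec2002

end Literature.NumberTheory.LFunctions

end
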